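import Literature.NumberTheory.QuadraticFields.RedeiMatrixFourRank
import HarnessLib

/-!
# Sub-lane «bsd-p2»: Legendre CONFIGURATIONS of a prime triple and the finite check behind the
# `hgen`-free class-7 door for `ω(n) = 3` (§1 of the series)

HONEST FRAMING (sub-lane «bsd-p2», run/shared/lean/b2b/bsd-rank1-residual/p2/, verbatim in every
file): the target of record is the FULL Birch–Swinnerton-Dyer formula for EVERY analytic-rank `≤ 1`
`E/ℚ` at ALL primes INCLUDING `2`; the odd-prime class ledger is referee A's; the `2`-part is OPEN
(cells O1 = X5 ∖ CM and O12 = the CM corner) and under census by «bsd-p2». Census / instrument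
output at `2` = EVIDENCE / conjecture items with held-out validation, NEVER a Literature fact;
certificates close PAIRS (one isogeny class, `p = 2`), never classes. This file asserts NO
arithmetic fact; it contains only COMPUTABLE DEFINITIONS (matrices over `𝔽₂` read on a configuration) and ONE
theorem decided by `decide`.

WHAT IT DOES. A Legendre configuration of three odd primes is `(pᵢ mod 8, [(pⱼ/pᵢ) = −1])`. On it one
reads: the Faulkner–James Laplacian of `G(−n)` (`fjCfg`, verbatim the case split of
`FaulknerJames2007.fjArcNeg`); Li–Ma's Rédei matrices of `ℚ(√−d)` for every sub-product `d` (entries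
`[(D_b/p_a) = −1]` with `D_b = ±p_b`, the row/column of the prime `2` when `d ≡ 1 (mod 4)`), hence the
bit `g(d) mod 2 = [#ker RM = 2]` (`gBitCfg`, Rédei–Reichardt); and TYZ's genus sums `Σ₁, Σ₂ (mod 2)` of
`n = p₀p₁p₂` over its five decompositions with their printed residue filters (`sigma1Cfg`, `sigma2Cfg`).
`sigma_odd_of_card_ker_fjCfg_three`: on all `128` configurations with `p₀p₁p₂ ≡ 7 (mod 8)`,
`#NS(fjCfg) = 4 ⟹ Σ₁ odd ∨ Σ₂ odd` (`66` configurations satisfy the hypothesis: `48` with `Σ₁` odd, `18`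
with `Σ₂` odd) — p2-idea-2's THEOREM O-ρG at `k = 3`, configuration by configuration. That the REAL
quantities of a prime triple equal these readings is §2–§5 of the series; nothing here mentions a prime.
Part of the five-file series `CongruentClassSevenConfigurations` (§1: configurations + the finite
check) → `CongruentClassSevenConfigTransfer` (§2–§4: the prime tuple's data ARE functions of its
Legendre configuration) → `DecompositionsThreePrimes` (§5a) → `GenusSumsThreePrimes` (§5b) →
`CongruentClassSevenKernelGenusParity` (§6: the `hgen`-free lemma for `ω(n) = 3` and the family door);
WAKE-theoremU of p2-lead ML-42 (W1′), source p2-idea-2 `O-rhoG-NOTE.md` v0.4 §8–§9, dictionary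
countersigned in `p2/monsky/lit/A44-REDEI-GRAPH-COUNTERSIGN.md`. Unit `b2b-bsdres-p2-monsky-lit` GEN 7; NEW file.

References: [FaulknerJames2007] Def. 1.5, Def. 5.2, Lemma 5.1, Thm 1.2 (2); [LiMa2008] Lemma 0.1,
Def. 0.2, Thm 0.4; [TianYuanZhang2017] Thm 1.2, §1; [IrelandRosen1990] Ch. 5 §1–§2; [Cox2013] §5.B;
[Smith2016CongruentDensity] §2 Table 1 (`g(n) mod 2` as a determinant in the additive Legendre matrix).
-/

open Matrix Finset

set_option autoImplicit false

namespace Summit.BirchSwinnertonDyer.Rank1Residual.P2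

/-! ## §1 Legendre configurations: the abstract (computable) side -/

section Config

/-- The bit `[x ≡ 3 (mod 4)]` (= the additive Legendre symbol `((−1/x))_+` for odd `x`).
[cite: IrelandRosen1990, Ch. 5 §1 Prop. 5.1.2 (Euler's criterion at a = −1)] -/
def chi4Bit (x : ℕ) : ZMod 2 := if x % 4 = 3 then 1 else 0

/-- The bit `[x ≡ ±3 (mod 8)]` (= `((2/x))_+` for odd `x`; also Cox's `[(D/2) = −1]` for the prime
discriminant `D = ±x ≡ 1 (mod 4)` through which an odd prime `x` divides a discriminant).
[cite: IrelandRosen1990, Ch. 5 §1 Prop. 5.1.3 ((2/p) = (−1)^{(p²−1)/8})] -/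
def chi8Bit (x : ℕ) : ZMod 2 := if x % 8 = 3 ∨ x % 8 = 5 then 1 else 0

variable {t : ℕ}

/-- Arc indicator of the Faulkner–James graph `G(−n)` read on a CONFIGURATION: residues `r i`
(`= pᵢ mod 8`) and symbol bits `β a b` (`= [(p_b / p_a) = −1]`); verbatim the case split of
`FaulknerJames2007.fjArcNeg`. [cite: FaulknerJames2007, Def. 1.5 (the graph G(−n))] -/
def fjArcCfg (r : Fin t → ℕ) (β : Fin t → Fin t → ZMod 2) (i j : Fin (t + 1)) : ZMod 2 :=
  if i = j then 0 else
    Fin.cases (motive := fun _ => ZMod 2)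
      (Fin.cases (motive := fun _ => ZMod 2) 0 (fun b => chi8Bit (r b)) j)
      (fun a => if r a % 4 = 1 then Fin.cases (motive := fun _ => ZMod 2) 0 (fun b => β a b) j else 0)
      i

/-- The Laplace matrix of `G(−n)` over `𝔽₂` read on a configuration (cf. `fjLaplacianNeg`).
[cite: FaulknerJames2007, Def. 5.2 (Laplace matrix) and Lemma 5.1] -/
def fjCfg (r : Fin t → ℕ) (β : Fin t → Fin t → ZMod 2) :
    Matrix (Fin (t + 1)) (Fin (t + 1)) (ZMod 2) :=
  Matrix.of fun i j => if i = j then ∑ l ∈ univ.erase i, fjArcCfg r β i l else fjArcCfg r β i j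

/-- Off-diagonal entry of the Rédei matrix of `ℚ(√−d)`, `d = ∏ pᵢ` odd, read on a configuration:
`[(D_b / p_a) = −1]` with `D_b = p_b^* = ±p_b ≡ 1 (mod 4)`, i.e. `((p_b/p_a))_+ + ((−1/p_a))_+·[p_b ≡ 3 (4)]`.
[cite: LiMa2008, Lemma 0.1 and Def. 0.2 (p. 279)] -/
def redeiEntryCfg (r : Fin t → ℕ) (β : Fin t → Fin t → ZMod 2) (a b : Fin t) : ZMod 2 :=
  β a b + chi4Bit (r a) * chi4Bit (r b)

/-- Rédei matrix `RM(−d)` on a configuration, case `d ≡ 3 (mod 4)` (primes of `D = −d` are the `pᵢ`).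
[cite: LiMa2008, Def. 0.2 (p. 279)] -/
def redeiCfgOdd (r : Fin t → ℕ) (β : Fin t → Fin t → ZMod 2) : Matrix (Fin t) (Fin t) (ZMod 2) :=
  Matrix.of fun a b => if a = b then ∑ c ∈ univ.erase a, redeiEntryCfg r β a c else redeiEntryCfg r β a b

/-- Entries of `RM(−4d)` on a configuration, case `d ≡ 1 (mod 4)`: index `none ↦` the prime `2` /
the prime discriminant `−4`; `[(−4/p_a) = −1] = [p_a ≡ 3 (4)]`, `[(D_b/2) = −1] = [D_b ≡ 5 (8)] =
[p_b ≡ ±3 (8)]`. [cite: LiMa2008, Lemma 0.1 and Def. 0.2 (p. 279)] [cite: Cox2013, §5.B ((D/2))] -/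
def redeiEntryCfgEven (r : Fin t → ℕ) (β : Fin t → Fin t → ZMod 2) :
    Option (Fin t) → Option (Fin t) → ZMod 2
  | some a, some b => redeiEntryCfg r β a b
  | some a, none => chi4Bit (r a)
  | none, some b => chi8Bit (r b)
  | none, none => 0

/-- Rédei matrix `RM(−4d)` on a configuration, case `d ≡ 1 (mod 4)`. [cite: LiMa2008, Def. 0.2 (p. 279)] -/
def redeiCfgEven (r : Fin t → ℕ) (β : Fin t → Fin t → ZMod 2) :
    Matrix (Option (Fin t)) (Option (Fin t)) (ZMod 2) :=
  Matrix.of fun a b => if a = b then ∑ c ∈ univ.erase a, redeiEntryCfgEven r β a c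
    else redeiEntryCfgEven r β a b

/-- `g(d) mod 2` on a configuration (`d = ∏ pᵢ`): the Rédei kernel has `2` elements iff `g(d)` is odd
(Rédei–Reichardt); which matrix applies is decided by `d mod 4 = (∏ rᵢ) mod 4`.
[cite: LiMa2008, Thm. 0.4 (p. 280)] [cite: TianYuanZhang2017, §1 (p0002 L78–L86)] -/
def gBitCfg (r : Fin t → ℕ) (β : Fin t → Fin t → ZMod 2) : ZMod 2 :=
  if (∏ i, r i) % 4 = 1 then
    (if Fintype.card {v : Option (Fin t) → ZMod 2 // redeiCfgEven r β *ᵥ v = 0} = 2 then 1 else 0)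
  else
    (if Fintype.card {v : Fin t → ZMod 2 // redeiCfgOdd r β *ᵥ v = 0} = 2 then 1 else 0)

/-- `g(d_T) mod 2` for the divisor `d_T = ∏_{i ∈ T} pᵢ` of `n = p₀p₁p₂`, `T` given by an embedding
`e : Fin m → Fin 3` (the sub-configuration). [cite: TianYuanZhang2017, §1 (p0002 L78–L86)] -/
def gBitSub {m : ℕ} (e : Fin m → Fin 3) (r : Fin 3 → ℕ) (β : Fin 3 → Fin 3 → ZMod 2) : ZMod 2 :=
  gBitCfg (fun i => r (e i)) (fun a b => β (e a) (e b))

/-- The indicator `[P]` in `𝔽₂`. -/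
def bitOf (P : Prop) [Decidable P] : ZMod 2 := if P then 1 else 0

/-- `Σ₁(p₀p₁p₂) mod 2` on a configuration: the five non-ordered decompositions `{n}`, `{pᵢ, pⱼp_k}`
(three), `{p₀, p₁, p₂}`, kept when at most one block is `≢ 1 (mod 8)` (TYZ's first sum), each
contributing the product of the `g`-bits of its blocks. [cite: TianYuanZhang2017, Thm. 1.2 (Σ₁)] -/
def sigma1Cfg (r : Fin 3 → ℕ) (β : Fin 3 → Fin 3 → ZMod 2) : ZMod 2 :=
  gBitSub ![0, 1, 2] r β
  + bitOf (r 0 % 8 = 1 ∨ (r 1 * r 2) % 8 = 1) * (gBitSub ![0] r β * gBitSub ![1, 2] r β)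
  + bitOf (r 1 % 8 = 1 ∨ (r 0 * r 2) % 8 = 1) * (gBitSub ![1] r β * gBitSub ![0, 2] r β)
  + bitOf (r 2 % 8 = 1 ∨ (r 0 * r 1) % 8 = 1) * (gBitSub ![2] r β * gBitSub ![0, 1] r β)
  + bitOf ((r 0 % 8 = 1 ∧ r 1 % 8 = 1) ∨ (r 0 % 8 = 1 ∧ r 2 % 8 = 1) ∨ (r 1 % 8 = 1 ∧ r 2 % 8 = 1))
      * (gBitSub ![0] r β * gBitSub ![1] r β * gBitSub ![2] r β)

/-- TYZ's residue pattern for a two-block decomposition `{x, y}`: one block `≡ 5, 6, 7`, the other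
`≡ 1, 2, 3 (mod 8)` (a `Bool`, so that it is NOT a `Prop`-valued definition). [cite: TianYuanZhang2017, Thm. 1.2 (Σ₂)] -/
def pat₂ (x y : ℕ) : Bool :=
  ((x % 8 == 5 || x % 8 == 6 || x % 8 == 7) && (y % 8 == 1 || y % 8 == 2 || y % 8 == 3)) ||
  ((y % 8 == 5 || y % 8 == 6 || y % 8 == 7) && (x % 8 == 1 || x % 8 == 2 || x % 8 == 3))

/-- TYZ's residue pattern for a three-block decomposition `{x, y, z}`: some ordered pair of distinct
blocks is `(≡ 5,6,7; ≡ 1,2,3)` and the remaining block is `≡ 1 (mod 8)`. [cite: TianYuanZhang2017, Thm. 1.2 (Σ₂)] -/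
def pat₃ (x y z : ℕ) : Bool :=
  (pat₂ x y && z % 8 == 1) || (pat₂ x z && y % 8 == 1) || (pat₂ y z && x % 8 == 1)

/-- `Σ₂(p₀p₁p₂) mod 2` on a configuration (TYZ's second sum; the one-block decomposition `{n}` does
not occur since two distinct blocks `d₀, d₁` are required). [cite: TianYuanZhang2017, Thm. 1.2 (Σ₂)] -/
def sigma2Cfg (r : Fin 3 → ℕ) (β : Fin 3 → Fin 3 → ZMod 2) : ZMod 2 :=
  bitOf (pat₂ (r 0) (r 1 * r 2) = true) * (gBitSub ![0] r β * gBitSub ![1, 2] r β)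
  + bitOf (pat₂ (r 1) (r 0 * r 2) = true) * (gBitSub ![1] r β * gBitSub ![0, 2] r β)
  + bitOf (pat₂ (r 2) (r 0 * r 1) = true) * (gBitSub ![2] r β * gBitSub ![0, 1] r β)
  + bitOf (pat₃ (r 0) (r 1) (r 2) = true) * (gBitSub ![0] r β * gBitSub ![1] r β * gBitSub ![2] r β)

/-- The full table of symbol bits of a prime triple from the three UPPER bits `s 0 = [(p₁/p₀) = −1]`,
`s 1 = [(p₂/p₀) = −1]`, `s 2 = [(p₂/p₁) = −1]`, the lower ones by QUADRATIC RECIPROCITY: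
`((p_a/p_b))_+ = ((p_b/p_a))_+ + [p_a ≡ p_b ≡ 3 (mod 4)]`; diagonal `0` (unused).
[cite: IrelandRosen1990, Ch. 5 §2 Thm. 1 (quadratic reciprocity)] -/
def betaOf (r : Fin 3 → ℕ) (s : Fin 3 → ZMod 2) : Fin 3 → Fin 3 → ZMod 2 :=
  fun a b =>
    if a = b then 0 else
    if a.val < b.val then (if a.val = 0 then (if b.val = 1 then s 0 else s 1) else s 2)
    else (if b.val = 0 then (if a.val = 1 then s 0 else s 1) else s 2) + chi4Bit (r a) * chi4Bit (r b)

set_option maxHeartbeats 400000 in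
/-- **The finite check (`ω(n) = 3`).** For every Legendre configuration of three odd primes with
`p₀p₁p₂ ≡ 7 (mod 8)`: if the Faulkner–James Laplacian has exactly `4` null vectors then `Σ₁` or `Σ₂`
is odd (`128` configurations; `66` satisfy the hypothesis: `48` with `Σ₁` odd, `18` more with `Σ₂` odd).
Decided by `decide`; this is p2-idea-2's THEOREM O-ρG at `k = 3`, configuration by configuration.
[cite: TianYuanZhang2017, Thm. 1.2] [cite: FaulknerJames2007, Thm. 1.2 (2)] -/
theorem sigma_odd_of_card_ker_fjCfg_three :
    ∀ (r₀ r₁ r₂ : Fin 8) (s₀ s₁ s₂ : ZMod 2),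
      (r₀.val % 2 = 1 ∧ r₁.val % 2 = 1 ∧ r₂.val % 2 = 1) →
      (r₀.val * r₁.val * r₂.val) % 8 = 7 →
      Fintype.card {v : Fin 4 → ZMod 2 //
        fjCfg ![r₀.val, r₁.val, r₂.val] (betaOf ![r₀.val, r₁.val, r₂.val] ![s₀, s₁, s₂]) *ᵥ v = 0} = 4 →
      sigma1Cfg ![r₀.val, r₁.val, r₂.val] (betaOf ![r₀.val, r₁.val, r₂.val] ![s₀, s₁, s₂]) = 1 ∨
      sigma2Cfg ![r₀.val, r₁.val, r₂.val] (betaOf ![r₀.val, r₁.val, r₂.val] ![s₀, s₁, s₂]) = 1 := by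
  decide

end Config

end Summit.BirchSwinnertonDyer.Rank1Residual.P2
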